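import Summits.SmoothPoincare4.SmoothPoincare4.Theorems.DottedCircleRasmussenDcrGapStubFriendsH2HF3
import Literature.Topology.FourManifolds.MMSWRasmussenFacts

/-!
# Helper `helper_friendsCarrier_Vk_partA_partIII_rim` (piece of the registered stub
`helper_friendsCarrier_Vk_partA_partIII`, line `mk_friends`, skeleton v9) for crux `DcrGap`
(item stmt-SmoothPoincare4-16128, route route-SmoothPoincare4-DottedCircleRasmussen)

**The rim of the enlarged model slice disc.**  For a model slice disc `f₁` of the null-homologous model
knot `K₁ ⊂ M_k`, `δ` in the neat zone (hole terms `> ½` on `1 ≤ |x| ≤ 1 + δ`) and the rim level below `1 - κ`: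

* the shrunken handlebody `D' = {∀ j, 1 ≤ |z - c_j|²} ∩ {G_k ≤ 1 - κ}` is closed;
* the rim circle `f₁(|x| = 1 + δ)` lies in `D'` (a hole term `< 1` would force `G_k > 1`,
  `FriendsH2.levelFun_bounds`);
* for every hole `j`, the plane loop `z ∘ f₁((1 + δ)·)` of the rim is freely null-homotopic in `ℂ ∖ {c_j}`:
  slide the radius from `1 + δ` to `1` through the neat zone (there `|z - c_j|² > ½`, so `z ≠ c_j`), reaching
  `z ∘ K₁`, which is null-homotopic by `IsNullHomologous`.

* `helper_friendsCarrier_Vk_partA_partIII_rim` — the three facts.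

No definitions, no named facts, no `sorry`.

## References

* C. Manolescu, M. Marengon, S. Sarkar, M. Willis, Duke Math. J. 172 (2023), §3.1. [ManolescuMarengonSarkarWillis2023]
-/

-- the prescribed namespace `Summit.<P>.<Sub>.…` duplicates `SmoothPoincare4` (P = Sub)
set_option linter.dupNamespace false
set_option linter.style.longLine false

noncomputable section

open scoped Manifold ContDiff Topology
open Set Function Metric Filter Complex
open Literature.Topology.FourManifolds Literature.Topology.FourManifolds.MMSW
  Literature.AlgebraicTopology.Homotopy.HopfFibration

namespace Summit.SmoothPoincare4.SmoothPoincare4.Theorems.DcrGap.MkFriends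

namespace FriendsCarrierVk

/-- **The shrunken handlebody `D_k^{≤ 1-κ}` is closed.** [folklore] -/
theorem isClosed_shrunkenHandlebody (k : ℕ) (κ : ℝ) :
    IsClosed {y : EuclideanSpace ℝ (Fin 4) | (∀ j, (1 : ℝ) ≤ holeTerm k j y) ∧ levelFun k y ≤ 1 - κ} := by
  have hG : IsClosed {y : EuclideanSpace ℝ (Fin 4) | ∀ j, (1 : ℝ) ≤ holeTerm k j y} := by
    have : {y : EuclideanSpace ℝ (Fin 4) | ∀ j, (1 : ℝ) ≤ holeTerm k j y} = ⋂ j, {y | (1 : ℝ) ≤ holeTerm k j y} := by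
      ext y; simp
    rw [this]
    refine isClosed_iInter fun j => isClosed_le continuous_const ?_
    unfold holeTerm; fun_prop
  have hcont : ContinuousOn (levelFun k) {y : EuclideanSpace ℝ (Fin 4) | ∀ j, (1 : ℝ) ≤ holeTerm k j y} := fun y hy =>
    (contDiffAt_levelFun fun j => (one_pos.trans_le (hy j)).ne').continuousAt.continuousWithinAt
  have : {y : EuclideanSpace ℝ (Fin 4) | (∀ j, (1 : ℝ) ≤ holeTerm k j y) ∧ levelFun k y ≤ 1 - κ} =
      {y : EuclideanSpace ℝ (Fin 4) | ∀ j, (1 : ℝ) ≤ holeTerm k j y} ∩ (levelFun k) ⁻¹' Iic (1 - κ) := by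
    ext y; simp
  rw [this]
  exact hcont.preimage_isClosed_of_isClosed hG isClosed_Iic

/-- **A point with all hole terms positive and level `< 1` satisfies the guard** `1 ≤ |z - c_j|²`: otherwise
`1/|z - c_j|² > 1` already exceeds the level. [folklore] -/
theorem one_le_holeTerm_of_levelFun_lt_one {k : ℕ} {y : EuclideanSpace ℝ (Fin 4)} (hy : ∀ j, 0 < holeTerm k j y)
    (hG : levelFun k y < 1) (j : Fin k) : (1 : ℝ) ≤ holeTerm k j y := by
  by_contra h
  push Not at h
  have h1 : 1 < 1 / holeTerm k j y := by rw [lt_one_div one_pos (hy j), div_one]; exact h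
  exact absurd ((h1.trans_le ((FriendsH2.levelFun_bounds hy).2.2 j)).trans hG) (lt_irrefl _)

/-- **The rim of the enlarged disc lies in the shrunken handlebody** (see the module docstring). [folklore] -/
theorem rim_mem_shrunkenHandlebody {k : ℕ} {f₁ : EuclideanSpace ℝ (Fin 2) → EuclideanSpace ℝ (Fin 4)} {δ κ : ℝ}
    (hδ : 0 < δ) (_hκ : 0 < κ)
    (hann : ∀ x : EuclideanSpace ℝ (Fin 2), 1 ≤ ‖x‖ → ‖x‖ ≤ 1 + δ → ∀ j, (1 : ℝ) / 2 < holeTerm k j (f₁ x))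
    (hrim : ∀ u : (sphere (0 : EuclideanSpace ℝ (Fin 2)) 1), levelFun k (f₁ ((1 + δ) • (u : EuclideanSpace ℝ (Fin 2)))) < 1 - κ)
    (x : EuclideanSpace ℝ (Fin 2)) (hx : ‖x‖ = 1 + δ) :
    f₁ x ∈ {y : EuclideanSpace ℝ (Fin 4) | (∀ j, (1 : ℝ) ≤ holeTerm k j y) ∧ levelFun k y ≤ 1 - κ} := by
  have hx0 : x ≠ 0 := by rintro rfl; rw [norm_zero] at hx; linarith
  let u : (sphere (0 : EuclideanSpace ℝ (Fin 2)) 1) := ⟨‖x‖⁻¹ • x, by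
    rw [mem_sphere_zero_iff_norm, norm_smul, norm_inv, norm_norm, inv_mul_cancel₀ (norm_ne_zero_iff.2 hx0)]⟩
  have hxu : (1 + δ) • (u : EuclideanSpace ℝ (Fin 2)) = x := by
    change (1 + δ) • (‖x‖⁻¹ • x) = x
    rw [smul_smul, hx, mul_inv_cancel₀ (by linarith), one_smul]
  have hG : levelFun k (f₁ x) < 1 - κ := by rw [← hxu]; exact hrim u
  have hpos : ∀ j, 0 < holeTerm k j (f₁ x) := fun j => one_half_pos.trans (hann x (by linarith) hx.le j)
  exact ⟨fun j => one_le_holeTerm_of_levelFun_lt_one hpos (by linarith) j, hG.le⟩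

/-- **The plane loop of the rim is null-homotopic in `ℂ ∖ {c_j}`** for every hole `j` (see the module
docstring). [cite: ManolescuMarengonSarkarWillis2023, §3.1] -/
theorem rim_nullhomotopic {k : ℕ} {K₁ : (sphere (0 : EuclideanSpace ℝ (Fin 2)) 1) → EuclideanSpace ℝ (Fin 4)}
    {f₁ : EuclideanSpace ℝ (Fin 2) → EuclideanSpace ℝ (Fin 4)} (hf : IsModelSliceDisc k K₁ f₁) (hN : IsNullHomologous k K₁)
    {δ : ℝ} (hδ : 0 < δ)
    (hann : ∀ x : EuclideanSpace ℝ (Fin 2), 1 ≤ ‖x‖ → ‖x‖ ≤ 1 + δ → ∀ j, (1 : ℝ) / 2 < holeTerm k j (f₁ x)) (j : Fin k) :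
    ∃ H : unitInterval × (sphere (0 : EuclideanSpace ℝ (Fin 2)) 1) → ℂ, Continuous H ∧ (∀ p, H p ≠ holeCentre k j) ∧
      (∀ u, H (0, u) = zC (f₁ ((1 + δ) • (u : EuclideanSpace ℝ (Fin 2))))) ∧ ∃ c : ℂ, ∀ u, H (1, u) = c := by
  have hfc : Continuous f₁ := hf.1.continuous
  obtain ⟨Hj, hHjc, hHjne, hHj0, c, hHj1⟩ := hN j
  -- the plane point of the disc stays off `c_j` on the neat zone
  have hne : ∀ x : EuclideanSpace ℝ (Fin 2), 1 ≤ ‖x‖ → ‖x‖ ≤ 1 + δ → zC (f₁ x) ≠ holeCentre k j := by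
    intro x h1 h2 h
    have := hann x h1 h2 j
    rw [holeTerm_eq_normSq, h, sub_self, map_zero] at this
    linarith
  let Y := {z : ℂ // z ≠ holeCentre k j}
  -- the three loops as maps into `ℂ ∖ {c_j}`
  have hnu : ∀ u : (sphere (0 : EuclideanSpace ℝ (Fin 2)) 1), ‖(1 + δ) • (u : EuclideanSpace ℝ (Fin 2))‖ = 1 + δ := fun u => by
    rw [norm_smul, norm_eq_of_mem_sphere u, mul_one, Real.norm_of_nonneg (by linarith)]
  let φ₀ : C((sphere (0 : EuclideanSpace ℝ (Fin 2)) 1), Y) :=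
    ⟨fun u => ⟨zC (f₁ ((1 + δ) • (u : EuclideanSpace ℝ (Fin 2)))),
        hne _ (by rw [hnu u]; linarith) (by rw [hnu u])⟩,
      (continuous_zC.comp (hfc.comp (continuous_subtype_val.const_smul (1 + δ)))).subtype_mk _⟩
  let φ₁ : C((sphere (0 : EuclideanSpace ℝ (Fin 2)) 1), Y) :=
    ⟨fun u => ⟨zC (f₁ (u : EuclideanSpace ℝ (Fin 2))),
        hne _ (by rw [norm_eq_of_mem_sphere u]) (by rw [norm_eq_of_mem_sphere u]; linarith)⟩,
      (continuous_zC.comp (hfc.comp continuous_subtype_val)).subtype_mk _⟩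
  let u₀ : (sphere (0 : EuclideanSpace ℝ (Fin 2)) 1) := ⟨EuclideanSpace.single 0 1, by simp⟩
  let φ₂ : C((sphere (0 : EuclideanSpace ℝ (Fin 2)) 1), Y) :=
    ⟨fun _ => ⟨c, by rw [← hHj1 u₀]; exact hHjne _⟩, continuous_const⟩
  -- sliding the radius through the neat zone
  have hrad : ∀ σ : unitInterval, 1 ≤ 1 + (1 - (σ : ℝ)) * δ ∧ 1 + (1 - (σ : ℝ)) * δ ≤ 1 + δ := fun σ =>
    ⟨by nlinarith [σ.2.2, hδ], by nlinarith [σ.2.1, hδ]⟩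
  let G₁ : ContinuousMap.Homotopy φ₀ φ₁ :=
    { toFun := fun q => ⟨zC (f₁ ((1 + (1 - (q.1 : ℝ)) * δ) • (q.2 : EuclideanSpace ℝ (Fin 2)))), hne _
        (by rw [norm_smul, norm_eq_of_mem_sphere q.2, mul_one, Real.norm_of_nonneg (by linarith [(hrad q.1).1])]
            exact (hrad q.1).1)
        (by rw [norm_smul, norm_eq_of_mem_sphere q.2, mul_one, Real.norm_of_nonneg (by linarith [(hrad q.1).1])]
            exact (hrad q.1).2)⟩
      continuous_toFun := by
        refine Continuous.subtype_mk (continuous_zC.comp (hfc.comp ?_)) _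
        exact ((continuous_const.add ((continuous_const.sub (continuous_subtype_val.comp continuous_fst)).mul
          continuous_const)).smul (continuous_subtype_val.comp continuous_snd))
      map_zero_left := fun u => by
        apply Subtype.ext
        change zC (f₁ ((1 + (1 - ((0 : unitInterval) : ℝ)) * δ) • (u : EuclideanSpace ℝ (Fin 2)))) =
          zC (f₁ ((1 + δ) • (u : EuclideanSpace ℝ (Fin 2))))
        rw [Set.Icc.coe_zero, sub_zero, one_mul]
      map_one_left := fun u => by
        apply Subtype.ext
        change zC (f₁ ((1 + (1 - ((1 : unitInterval) : ℝ)) * δ) • (u : EuclideanSpace ℝ (Fin 2)))) =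
          zC (f₁ (u : EuclideanSpace ℝ (Fin 2)))
        rw [Set.Icc.coe_one, sub_self, zero_mul, add_zero, one_smul] }
  let G₂ : ContinuousMap.Homotopy φ₁ φ₂ :=
    { toFun := fun q => ⟨Hj q, hHjne q⟩
      continuous_toFun := hHjc.subtype_mk _
      map_zero_left := fun u => by
        apply Subtype.ext
        change Hj (0, u) = zC (f₁ u)
        rw [hHj0 u, hf.apply_sphere u]
      map_one_left := fun u => Subtype.ext (hHj1 u) }
  let G := G₁.trans G₂
  refine ⟨fun q => ((G q : Y) : ℂ), continuous_subtype_val.comp G.continuous, fun q => (G q).2, fun u => ?_, c, fun u => ?_⟩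
  · change ((G (0, u) : Y) : ℂ) = _
    rw [G.apply_zero]; rfl
  · change ((G (1, u) : Y) : ℂ) = _
    rw [G.apply_one]; rfl

end FriendsCarrierVk

open FriendsCarrierVk in
/-- **Helper `helper_friendsCarrier_Vk_partA_partIII_rim`** (piece of `helper_friendsCarrier_Vk_partA_partIII`:
the shrunken handlebody is closed, the rim of the enlarged disc lies in it, and the plane loop of the rim is
null-homotopic off every hole centre; see the module docstring). [cite: ManolescuMarengonSarkarWillis2023, §3.1] -/
theorem helper_friendsCarrier_Vk_partA_partIII_rim : ∀ (k : ℕ) (K₁ : (sphere (0 : EuclideanSpace ℝ (Fin 2)) 1) → EuclideanSpace ℝ (Fin 4)) (f₁ : EuclideanSpace ℝ (Fin 2) → EuclideanSpace ℝ (Fin 4)), IsModelSliceDisc k K₁ f₁ → IsNullHomologous k K₁ → ∀ (δ κ : ℝ), 0 < δ → 0 < κ → (∀ x : EuclideanSpace ℝ (Fin 2), 1 ≤ ‖x‖ → ‖x‖ ≤ 1 + δ → ∀ j, (1 : ℝ) / 2 < holeTerm k j (f₁ x)) → (∀ u : (sphere (0 : EuclideanSpace ℝ (Fin 2)) 1),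 levelFun k (f₁ ((1 + δ) • (u : EuclideanSpace ℝ (Fin 2)))) < 1 - κ) → IsClosed {y : EuclideanSpace ℝ (Fin 4) | (∀ j, (1 : ℝ) ≤ holeTerm k j y) ∧ levelFun k y ≤ 1 - κ} ∧ (∀ x : EuclideanSpace ℝ (Fin 2), ‖x‖ = 1 + δ → f₁ x ∈ {y : EuclideanSpace ℝ (Fin 4) | (∀ j, (1 : ℝ) ≤ holeTerm k j y) ∧ levelFun k y ≤ 1 - κ}) ∧ ∀ j : Fin k, ∃ H : unitInterval × (sphere (0 : EuclideanSpace ℝ (Fin 2)) 1) → ℂ, Continuous H ∧ (∀ p, H p ≠ holeCentre k j) ∧ (∀ u, H (0, u) = zC (f₁ ((1 + δ) • (u : EuclideanSpace ℝ (Fin 2))))) ∧ ∃ c : ℂ, ∀ u, H (1, u) = c :=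
  fun k _ _ hf hN _ κ hδ hκ hann hrim =>
    ⟨isClosed_shrunkenHandlebody k κ, rim_mem_shrunkenHandlebody hδ hκ hann hrim, rim_nullhomotopic hf hN hδ hann⟩

end Summit.SmoothPoincare4.SmoothPoincare4.Theorems.DcrGap.MkFriends

end
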